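import Summits.QuantumFields.YangMills.Theorems.FluctuationComparisonRegPrIntLOrganTangentLawSquareResponse
import HarnessLib

/-!
# Crux `FluctuationComparisonRegPrIntL` (stmt-QuantumFields-20520, rung R3), PATH-B organ, H-currency cone — (L26a) «LAW RESPONSES OF SECOND MOMENTS»: the
# covariance-edge and variance-square engines for the D4 law-side brackets (JV3-h′) ∕ (JV4-h′), Mathlib-only (over ✓(L23a) p815758, ✓(L24) p816100)

Cell `ym3-torus` (YM ladder rung R3 = continuum `SU(2)` Yang–Mills on the three-torus — a RUNG: NOT d = 4, NOT infinite volume, NOT a mass gap, NOT Clay).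
Width seat `ym-ust-20520-w5` (gen 24), `--supports stmt-QuantumFields-20520 --as helper`, count-neutral, no registry ∕ binder ∕ `Lines/` edit, DEFINITION-FREE,
default heartbeats; LEAD w3 g26 №22 (1): «the D4 law-side brackets (JV3-h′) `Δ^{law} Cov` and (JV4-h′) `ΔΔ^{law} Var` are the SAME engine one cumulant up — first refusal w5».

* §1 ★`normCov_deriv_eq_cum3_of_null` — ✓(L23a) `normCov_deriv_eq_cum3` (score reading of the covariance response: each «`N(X) − E(X)·N(1)`» block is the own-law covariance of
  `X ∈ {AB, A, B}` with the score) under the WEAKER cut hypothesis «`w′ = 0` a.e. where `w = 0`» (✓(L24) `normMean_deriv_eq_cov_of_null` ×3).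
* §2 `integral_centred_sq_eq` — own-centred VARIANCE = `E[F²] − E[F]²` for `∫ ŵ = 1` (✓(L23a) `integral_centred_mul_eq` with `A = B`), and `integrable_centred_sq` ∕
  `integrable_centred_mul` — the rows' `Integrable ((F − c)²·ŵ)` ∕ `Integrable ((Δ − c)(S − e)·ŵ)` conjuncts from integrability of the monomials.
* §4 ★`nForm_eq_cum3_add_cov` — the kernel-checked SCORE∕CUMULANT READING of ✓(L24)'s N-form mixed kernel: under the cut clause and integrability of the score products,
  N-form `= κ₃(G, r₁, r₂) + Cov(G, r₁₂ − r₁r₂)` (`rᵢ = wᵢ∕w`, `r₁₂ = w₁₂∕w`, `r₁₂ − r₁r₂ = ∂₁(w₂∕w)`), both brackets CENTRED — the form a cluster-expansion supplier delivers.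
* §3 ★★`abs_normVar_secondDiff_le` — the VARIANCE SQUARE: for a two-parameter density family `w` with partial families `w₁ w₂ w₁₂` and a frozen `Fo`, the (L24) data for
  BOTH `G := Fo` and `G := Fo²` (+ the `s`-direction data of `Fo` for `φ₁`) and a uniform bound `ℓ` on `[0,1]²` of `ψ₁₂ − 2(φ₁·φ₂ + φ·φ₁₂)` (all five in closed N-form:
  `ψ = E[Fo²]`, `φ = E[Fo]`) ⟹ `|ΔΔ_{[0,1]²} (E[Fo²] − E[Fo]²)| ≤ ℓ` (✓(L24) `abs_secondDiff_var_le` fed by `hasDerivAt_normMean` ∕ `hasDerivAt_response_family`).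

HONEST FRAMING: generic plumbing [folklore]; no letter is priced, no cumulant is bounded; nothing of Bałaban's analysis is asserted or proved; `SpreadFibreLawH` ∕ `SpreadFibreLawHJ`
are HYPOTHESIS rows; LIN″ ∕ JVAR″ ∕ JEN″ ∕ O1ᵘ-H v2.2 ∕ S1aᴴ ∕ S3ᴴ ∕ S2α′ ∕ S2β, the five registered stubs of `Lines/semiclassical_s2beta.lean`, crux 20520 `FluctuationComparisonRegPrIntL`
and `YM3TorusSU2` are NOT proved; registry untouched; rung R3 = SU(2) YM₃ on T³ at fixed lattice data — NOT d = 4, NOT infinite volume, NOT a mass gap, NOT Clay; the Yang–Mills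
mass gap is NOT proved.  [folklore].
-/

set_option autoImplicit false

noncomputable section

namespace Summit.QuantumFields.YangMills.Theorems.OrganTangentLawCumulantResponse

open MeasureTheory Filter Topology Set
open scoped ENNReal
open Summit.QuantumFields.YangMills.Theorems.OrganTangentLawEdgeResponse
open Summit.QuantumFields.YangMills.Theorems.OrganTangentLawSquareResponse

variable {Z : Type*} [MeasurableSpace Z] {τ : Measure Z}

/-! ## §1 Score reading of the covariance response under the cut hypothesis -/

/-- ★ ✓(L23a) `normCov_deriv_eq_cum3` under «`w′_{s₀} = 0` a.e. where `w_{s₀} = 0`» (cut weights): the raw derivative of ★`hasDerivAt_normCov` equals its score form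
(own-law covariances of `AB`, `A`, `B` with `r = w′∕w` under `ŵ = w∕Z`; with ✓`integral_centred_mul3_eq` this is `κ₃(A, B, r)`). [folklore] -/
theorem normCov_deriv_eq_cum3_of_null {w w' : ℝ → Z → ℝ} {A B : Z → ℝ} {s₀ : ℝ} (hw : ∀ᵐ z ∂τ, w s₀ z = 0 → w' s₀ z = 0) :
    (((∫ z, (A z * B z) * w' s₀ z ∂τ) / (∫ z, w s₀ z ∂τ)
          - ((∫ z, (A z * B z) * w s₀ z ∂τ) / (∫ z, w s₀ z ∂τ)) * ((∫ z, w' s₀ z ∂τ) / (∫ z, w s₀ z ∂τ)))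
        - (((∫ z, A z * w' s₀ z ∂τ) / (∫ z, w s₀ z ∂τ)
              - ((∫ z, A z * w s₀ z ∂τ) / (∫ z, w s₀ z ∂τ)) * ((∫ z, w' s₀ z ∂τ) / (∫ z, w s₀ z ∂τ)))
            * ((∫ z, B z * w s₀ z ∂τ) / (∫ z, w s₀ z ∂τ))
          + ((∫ z, A z * w s₀ z ∂τ) / (∫ z, w s₀ z ∂τ))
            * ((∫ z, B z * w' s₀ z ∂τ) / (∫ z, w s₀ z ∂τ)
              - ((∫ z, B z * w s₀ z ∂τ) / (∫ z, w s₀ z ∂τ)) * ((∫ z, w' s₀ z ∂τ) / (∫ z, w s₀ z ∂τ)))))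
      = ((∫ z, (A z * B z) * (w' s₀ z / w s₀ z) * (w s₀ z / ∫ z', w s₀ z' ∂τ) ∂τ)
          - (∫ z, (A z * B z) * (w s₀ z / ∫ z', w s₀ z' ∂τ) ∂τ) * (∫ z, (w' s₀ z / w s₀ z) * (w s₀ z / ∫ z', w s₀ z' ∂τ) ∂τ))
        - (((∫ z, A z * (w' s₀ z / w s₀ z) * (w s₀ z / ∫ z', w s₀ z' ∂τ) ∂τ)
              - (∫ z, A z * (w s₀ z / ∫ z', w s₀ z' ∂τ) ∂τ) * (∫ z, (w' s₀ z / w s₀ z) * (w s₀ z / ∫ z', w s₀ z' ∂τ) ∂τ))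
            * (∫ z, B z * (w s₀ z / ∫ z', w s₀ z' ∂τ) ∂τ)
          + (∫ z, A z * (w s₀ z / ∫ z', w s₀ z' ∂τ) ∂τ)
            * ((∫ z, B z * (w' s₀ z / w s₀ z) * (w s₀ z / ∫ z', w s₀ z' ∂τ) ∂τ)
              - (∫ z, B z * (w s₀ z / ∫ z', w s₀ z' ∂τ) ∂τ) * (∫ z, (w' s₀ z / w s₀ z) * (w s₀ z / ∫ z', w s₀ z' ∂τ) ∂τ))) := by
  rw [normMean_deriv_eq_cov_of_null (G := fun z => A z * B z) hw, normMean_deriv_eq_cov_of_null (G := A) hw, normMean_deriv_eq_cov_of_null (G := B) hw,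
    integral_mul_div_const A (w s₀), integral_mul_div_const B (w s₀)]

/-! ## §2 Own-centred second moments from the monomials -/

/-- Own-centred variance = `E[F²] − E[F]²` for a probability weight (`∫ ŵ = 1`). [folklore] -/
theorem integral_centred_sq_eq {ŵ A : Z → ℝ} (h1 : ∫ z, ŵ z ∂τ = 1)
    (hA : Integrable (fun z => A z * ŵ z) τ) (hAA : Integrable (fun z => A z * A z * ŵ z) τ) (hw : Integrable ŵ τ) :
    ∫ z, (A z - ∫ z', A z' * ŵ z' ∂τ) ^ 2 * ŵ z ∂τ = (∫ z, A z * A z * ŵ z ∂τ) - (∫ z, A z * ŵ z ∂τ) * (∫ z, A z * ŵ z ∂τ) := by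
  rw [← integral_centred_mul_eq h1 hA hA hAA hw]
  exact integral_congr_ae (Eventually.of_forall fun z => by ring)

/-- `Integrable ((A − a)(B − b)·ŵ)` from the monomials `AB·ŵ, A·ŵ, B·ŵ, ŵ` (any constants `a b`). [folklore] -/
theorem integrable_centred_mul {ŵ A B : Z → ℝ} (a b : ℝ)
    (hA : Integrable (fun z => A z * ŵ z) τ) (hB : Integrable (fun z => B z * ŵ z) τ)
    (hAB : Integrable (fun z => A z * B z * ŵ z) τ) (hw : Integrable ŵ τ) :
    Integrable (fun z => (A z - a) * (B z - b) * ŵ z) τ := by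
  have e : (fun z => (A z - a) * (B z - b) * ŵ z)
      = fun z => ((A z * B z * ŵ z - b * (A z * ŵ z)) - a * (B z * ŵ z)) + (a * b) * ŵ z := by
    funext z; ring
  rw [e]
  exact ((hAB.sub (hA.const_mul b)).sub (hB.const_mul a)).add (hw.const_mul (a * b))

/-- `Integrable ((A − a)²·ŵ)` from `A²·ŵ, A·ŵ, ŵ`. [folklore] -/
theorem integrable_centred_sq {ŵ A : Z → ℝ} (a : ℝ)
    (hA : Integrable (fun z => A z * ŵ z) τ) (hAA : Integrable (fun z => A z * A z * ŵ z) τ) (hw : Integrable ŵ τ) :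
    Integrable (fun z => (A z - a) ^ 2 * ŵ z) τ := by
  have e : (fun z => (A z - a) ^ 2 * ŵ z) = fun z => (A z - a) * (A z - a) * ŵ z := by
    funext z; ring
  rw [e]
  exact integrable_centred_mul a a hA hA hAA hw


/-! ## §3 The variance square along a two-parameter density family -/

/-- ★★ **THE VARIANCE SQUARE** (the (JV4-h′) shape, uncentred `E[Fo²] − E[Fo]²`).  Data: a two-parameter `τ`-density family `w` with partial families `w₁ w₂ w₁₂` on an open
`U ⊇ [0,1]`, a frozen `Fo`; measurability; integrability on `[0,1]²` of `w, Fo·w, Fo²·w, w₂, Fo·w₂, Fo²·w₂`; a.e. dominators on `U²` of the nine families `w₁, Fo·w₁, Fo²·w₁,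
w₂, Fo·w₂, Fo²·w₂, w₁₂, Fo·w₁₂, Fo²·w₁₂`; a.e. differentiability; masses `≠ 0`.  The seven path functionals `φ = E[Fo]`, `φ₁`, `φ₂` (first responses), `φ₁₂` (N-form mixed
response), `ψ = E[Fo²]`, `ψ₂`, `ψ₁₂` are BINDERS tied to the family by their defining equations (so the kernel hypothesis reads `|ψ₁₂ − 2(φ₁φ₂ + φφ₁₂)| ≤ ℓ` on `[0,1]²`);
conclusion `|ΔΔ_{[0,1]²}(ψ − φ²)| ≤ ℓ` (✓(L24) `abs_secondDiff_var_le`, its five `HasDerivAt` inputs produced here by ✓(L23a) `hasDerivAt_normMean` and ✓(L24)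
`hasDerivAt_response_family`). [folklore] -/
theorem abs_normVar_secondDiff_le {w w₁ w₂ w₁₂ : ℝ → ℝ → Z → ℝ} {Fo : Z → ℝ} {U : Set ℝ} (hU : IsOpen U) (hUI : Icc (0:ℝ) 1 ⊆ U)
    (hFo : AEStronglyMeasurable Fo τ) (hm : ∀ s s', AEStronglyMeasurable (w s s') τ) (hm₁ : ∀ s s', AEStronglyMeasurable (w₁ s s') τ)
    (hm₂ : ∀ s s', AEStronglyMeasurable (w₂ s s') τ) (hm₁₂ : ∀ s s', AEStronglyMeasurable (w₁₂ s s') τ)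
    (hi : ∀ s ∈ Icc (0:ℝ) 1, ∀ s' ∈ Icc (0:ℝ) 1, Integrable (w s s') τ)
    (hiF : ∀ s ∈ Icc (0:ℝ) 1, ∀ s' ∈ Icc (0:ℝ) 1, Integrable (fun z => Fo z * w s s' z) τ)
    (hiFF : ∀ s ∈ Icc (0:ℝ) 1, ∀ s' ∈ Icc (0:ℝ) 1, Integrable (fun z => (Fo z * Fo z) * w s s' z) τ)
    (hi₂ : ∀ s ∈ Icc (0:ℝ) 1, ∀ s' ∈ Icc (0:ℝ) 1, Integrable (w₂ s s') τ)
    (hiF₂ : ∀ s ∈ Icc (0:ℝ) 1, ∀ s' ∈ Icc (0:ℝ) 1, Integrable (fun z => Fo z * w₂ s s' z) τ)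
    (hiFF₂ : ∀ s ∈ Icc (0:ℝ) 1, ∀ s' ∈ Icc (0:ℝ) 1, Integrable (fun z => (Fo z * Fo z) * w₂ s s' z) τ)
    {b₁ : Z → ℝ} (hb₁ : ∀ᵐ z ∂τ, ∀ s ∈ U, ∀ s' ∈ U, |w₁ s s' z| ≤ b₁ z) (hb₁i : Integrable b₁ τ)
    {b₁F : Z → ℝ} (hb₁F : ∀ᵐ z ∂τ, ∀ s ∈ U, ∀ s' ∈ U, |Fo z * w₁ s s' z| ≤ b₁F z) (hb₁Fi : Integrable b₁F τ)
    {b₁FF : Z → ℝ} (hb₁FF : ∀ᵐ z ∂τ, ∀ s ∈ U, ∀ s' ∈ U, |(Fo z * Fo z) * w₁ s s' z| ≤ b₁FF z) (hb₁FFi : Integrable b₁FF τ)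
    {b₂ : Z → ℝ} (hb₂ : ∀ᵐ z ∂τ, ∀ s ∈ U, ∀ s' ∈ U, |w₂ s s' z| ≤ b₂ z) (hb₂i : Integrable b₂ τ)
    {b₂F : Z → ℝ} (hb₂F : ∀ᵐ z ∂τ, ∀ s ∈ U, ∀ s' ∈ U, |Fo z * w₂ s s' z| ≤ b₂F z) (hb₂Fi : Integrable b₂F τ)
    {b₂FF : Z → ℝ} (hb₂FF : ∀ᵐ z ∂τ, ∀ s ∈ U, ∀ s' ∈ U, |(Fo z * Fo z) * w₂ s s' z| ≤ b₂FF z) (hb₂FFi : Integrable b₂FF τ)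
    {b₁₂ : Z → ℝ} (hb₁₂ : ∀ᵐ z ∂τ, ∀ s ∈ U, ∀ s' ∈ U, |w₁₂ s s' z| ≤ b₁₂ z) (hb₁₂i : Integrable b₁₂ τ)
    {b₁₂F : Z → ℝ} (hb₁₂F : ∀ᵐ z ∂τ, ∀ s ∈ U, ∀ s' ∈ U, |Fo z * w₁₂ s s' z| ≤ b₁₂F z) (hb₁₂Fi : Integrable b₁₂F τ)
    {b₁₂FF : Z → ℝ} (hb₁₂FF : ∀ᵐ z ∂τ, ∀ s ∈ U, ∀ s' ∈ U, |(Fo z * Fo z) * w₁₂ s s' z| ≤ b₁₂FF z) (hb₁₂FFi : Integrable b₁₂FF τ)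
    (hd₂ : ∀ᵐ z ∂τ, ∀ s ∈ U, ∀ s' ∈ U, HasDerivAt (fun s' => w s s' z) (w₂ s s' z) s')
    (hd₁ : ∀ᵐ z ∂τ, ∀ s ∈ U, ∀ s' ∈ U, HasDerivAt (fun s => w s s' z) (w₁ s s' z) s)
    (hd₁₂ : ∀ᵐ z ∂τ, ∀ s ∈ U, ∀ s' ∈ U, HasDerivAt (fun s => w₂ s s' z) (w₁₂ s s' z) s)
    (hZ : ∀ s ∈ Icc (0:ℝ) 1, ∀ s' ∈ Icc (0:ℝ) 1, ∫ z, w s s' z ∂τ ≠ 0)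
    (φ φ₁ φ₂ φ₁₂ ψ ψ₂ ψ₁₂ : ℝ → ℝ → ℝ)
    (hφ : ∀ s s', φ s s' = (∫ z, Fo z * w s s' z ∂τ) / (∫ z, w s s' z ∂τ))
    (hφ₁ : ∀ s s', φ₁ s s' = (∫ z, Fo z * w₁ s s' z ∂τ) / (∫ z, w s s' z ∂τ)
      - ((∫ z, Fo z * w s s' z ∂τ) / (∫ z, w s s' z ∂τ)) * ((∫ z, w₁ s s' z ∂τ) / (∫ z, w s s' z ∂τ)))
    (hφ₂ : ∀ s s', φ₂ s s' = (∫ z, Fo z * w₂ s s' z ∂τ) / (∫ z, w s s' z ∂τ)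
      - ((∫ z, Fo z * w s s' z ∂τ) / (∫ z, w s s' z ∂τ)) * ((∫ z, w₂ s s' z ∂τ) / (∫ z, w s s' z ∂τ)))
    (hφ₁₂ : ∀ s s', φ₁₂ s s' = ((∫ z, Fo z * w₁₂ s s' z ∂τ) / (∫ z, w s s' z ∂τ)
          - ((∫ z, Fo z * w₂ s s' z ∂τ) / (∫ z, w s s' z ∂τ)) * ((∫ z, w₁ s s' z ∂τ) / (∫ z, w s s' z ∂τ)))
        - ((((∫ z, Fo z * w₁ s s' z ∂τ) / (∫ z, w s s' z ∂τ)
              - ((∫ z, Fo z * w s s' z ∂τ) / (∫ z, w s s' z ∂τ)) * ((∫ z, w₁ s s' z ∂τ) / (∫ z, w s s' z ∂τ)))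
            * ((∫ z, w₂ s s' z ∂τ) / (∫ z, w s s' z ∂τ)))
          + ((∫ z, Fo z * w s s' z ∂τ) / (∫ z, w s s' z ∂τ))
            * ((∫ z, w₁₂ s s' z ∂τ) / (∫ z, w s s' z ∂τ)
              - ((∫ z, w₂ s s' z ∂τ) / (∫ z, w s s' z ∂τ)) * ((∫ z, w₁ s s' z ∂τ) / (∫ z, w s s' z ∂τ)))))
    (hψ : ∀ s s', ψ s s' = (∫ z, (Fo z * Fo z) * w s s' z ∂τ) / (∫ z, w s s' z ∂τ))
    (hψ₂ : ∀ s s', ψ₂ s s' = (∫ z, (Fo z * Fo z) * w₂ s s' z ∂τ) / (∫ z, w s s' z ∂τ)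
      - ((∫ z, (Fo z * Fo z) * w s s' z ∂τ) / (∫ z, w s s' z ∂τ)) * ((∫ z, w₂ s s' z ∂τ) / (∫ z, w s s' z ∂τ)))
    (hψ₁₂ : ∀ s s', ψ₁₂ s s' = ((∫ z, (Fo z * Fo z) * w₁₂ s s' z ∂τ) / (∫ z, w s s' z ∂τ)
          - ((∫ z, (Fo z * Fo z) * w₂ s s' z ∂τ) / (∫ z, w s s' z ∂τ)) * ((∫ z, w₁ s s' z ∂τ) / (∫ z, w s s' z ∂τ)))
        - ((((∫ z, (Fo z * Fo z) * w₁ s s' z ∂τ) / (∫ z, w s s' z ∂τ)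
              - ((∫ z, (Fo z * Fo z) * w s s' z ∂τ) / (∫ z, w s s' z ∂τ)) * ((∫ z, w₁ s s' z ∂τ) / (∫ z, w s s' z ∂τ)))
            * ((∫ z, w₂ s s' z ∂τ) / (∫ z, w s s' z ∂τ)))
          + ((∫ z, (Fo z * Fo z) * w s s' z ∂τ) / (∫ z, w s s' z ∂τ))
            * ((∫ z, w₁₂ s s' z ∂τ) / (∫ z, w s s' z ∂τ)
              - ((∫ z, w₂ s s' z ∂τ) / (∫ z, w s s' z ∂τ)) * ((∫ z, w₁ s s' z ∂τ) / (∫ z, w s s' z ∂τ)))))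
    {ℓ : ℝ} (hker : ∀ s ∈ Icc (0:ℝ) 1, ∀ s' ∈ Icc (0:ℝ) 1, |ψ₁₂ s s' - 2 * (φ₁ s s' * φ₂ s s' + φ s s' * φ₁₂ s s')| ≤ ℓ) :
    |(ψ 1 1 - φ 1 1 * φ 1 1) - (ψ 1 0 - φ 1 0 * φ 1 0) - (ψ 0 1 - φ 0 1 * φ 0 1) + (ψ 0 0 - φ 0 0 * φ 0 0)| ≤ ℓ := by
  have hFF : AEStronglyMeasurable (fun z => Fo z * Fo z) τ := hFo.mul hFo
  refine abs_secondDiff_var_le (ψ := ψ) (ψ₂ := ψ₂) (ψ₁₂ := ψ₁₂) (φ := φ) (φ₁ := φ₁) (φ₂ := φ₂) (φ₁₂ := φ₁₂)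
    (fun s hs s' hs' => ?_) (fun s hs s' hs' => ?_) (fun s hs s' hs' => ?_) (fun s hs s' hs' => ?_) (fun s hs s' hs' => ?_) hker
  · -- ψ₂ : the `s′`-response of `E[Fo²]`
    have hsU : s ∈ U := hUI hs
    have e : (fun s' => ψ s s') = fun s' => (∫ z, (Fo z * Fo z) * w s s' z ∂τ) / (∫ z, w s s' z ∂τ) := funext fun s' => hψ s s'
    rw [e, hψ₂]
    exact hasDerivAt_normMean (w := fun s' => w s s') (w' := fun s' => w₂ s s') (hU.mem_nhds (hUI hs')) hFF (fun s' => hm s s')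
      (hi s hs s' hs') (hiFF s hs s' hs') (hm₂ s s')
      (by filter_upwards [hb₂] with z hz s' hs'; exact hz s hsU s' hs') hb₂i
      (by filter_upwards [hb₂FF] with z hz s' hs'; exact hz s hsU s' hs') hb₂FFi
      (by filter_upwards [hd₂] with z hz s' hs'; exact hz s hsU s' hs') (hZ s hs s' hs')
  · -- ψ₁₂
    have hs'U : s' ∈ U := hUI hs'
    have e : (fun s => ψ₂ s s') = fun s => (∫ z, (Fo z * Fo z) * w₂ s s' z ∂τ) / (∫ z, w s s' z ∂τ)
        - ((∫ z, (Fo z * Fo z) * w s s' z ∂τ) / (∫ z, w s s' z ∂τ)) * ((∫ z, w₂ s s' z ∂τ) / (∫ z, w s s' z ∂τ)) := funext fun s => hψ₂ s s'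
    rw [e, hψ₁₂]
    exact hasDerivAt_response_family (v := fun s => w s s') (v₁ := fun s => w₁ s s') (u := fun s => w₂ s s') (u₁ := fun s => w₁₂ s s')
      (hU.mem_nhds (hUI hs)) hFF (fun s => hm s s') (fun s => hm₂ s s') (hm₁ s s') (hm₁₂ s s')
      (hi s hs s' hs') (hiFF s hs s' hs') (hi₂ s hs s' hs') (hiFF₂ s hs s' hs')
      (by filter_upwards [hb₁] with z hz s hs; exact hz s hs s' hs'U) hb₁i
      (by filter_upwards [hb₁FF] with z hz s hs; exact hz s hs s' hs'U) hb₁FFi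
      (by filter_upwards [hb₁₂] with z hz s hs; exact hz s hs s' hs'U) hb₁₂i
      (by filter_upwards [hb₁₂FF] with z hz s hs; exact hz s hs s' hs'U) hb₁₂FFi
      (by filter_upwards [hd₁] with z hz s hs; exact hz s hs s' hs'U)
      (by filter_upwards [hd₁₂] with z hz s hs; exact hz s hs s' hs'U) (hZ s hs s' hs')
  · -- φ₁ : the `s`-response of `E[Fo]`
    have hs'U : s' ∈ U := hUI hs'
    have e : (fun s => φ s s') = fun s => (∫ z, Fo z * w s s' z ∂τ) / (∫ z, w s s' z ∂τ) := funext fun s => hφ s s'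
    rw [e, hφ₁]
    exact hasDerivAt_normMean (w := fun s => w s s') (w' := fun s => w₁ s s') (hU.mem_nhds (hUI hs)) hFo (fun s => hm s s')
      (hi s hs s' hs') (hiF s hs s' hs') (hm₁ s s')
      (by filter_upwards [hb₁] with z hz s hs; exact hz s hs s' hs'U) hb₁i
      (by filter_upwards [hb₁F] with z hz s hs; exact hz s hs s' hs'U) hb₁Fi
      (by filter_upwards [hd₁] with z hz s hs; exact hz s hs s' hs'U) (hZ s hs s' hs')
  · -- φ₂
    have hsU : s ∈ U := hUI hs
    have e : (fun s' => φ s s') = fun s' => (∫ z, Fo z * w s s' z ∂τ) / (∫ z, w s s' z ∂τ) := funext fun s' => hφ s s'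
    rw [e, hφ₂]
    exact hasDerivAt_normMean (w := fun s' => w s s') (w' := fun s' => w₂ s s') (hU.mem_nhds (hUI hs')) hFo (fun s' => hm s s')
      (hi s hs s' hs') (hiF s hs s' hs') (hm₂ s s')
      (by filter_upwards [hb₂] with z hz s' hs'; exact hz s hsU s' hs') hb₂i
      (by filter_upwards [hb₂F] with z hz s' hs'; exact hz s hsU s' hs') hb₂Fi
      (by filter_upwards [hd₂] with z hz s' hs'; exact hz s hsU s' hs') (hZ s hs s' hs')
  · -- φ₁₂
    have hs'U : s' ∈ U := hUI hs'
    have e : (fun s => φ₂ s s') = fun s => (∫ z, Fo z * w₂ s s' z ∂τ) / (∫ z, w s s' z ∂τ)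
        - ((∫ z, Fo z * w s s' z ∂τ) / (∫ z, w s s' z ∂τ)) * ((∫ z, w₂ s s' z ∂τ) / (∫ z, w s s' z ∂τ)) := funext fun s => hφ₂ s s'
    rw [e, hφ₁₂]
    exact hasDerivAt_response_family (v := fun s => w s s') (v₁ := fun s => w₁ s s') (u := fun s => w₂ s s') (u₁ := fun s => w₁₂ s s')
      (hU.mem_nhds (hUI hs)) hFo (fun s => hm s s') (fun s => hm₂ s s') (hm₁ s s') (hm₁₂ s s')
      (hi s hs s' hs') (hiF s hs s' hs') (hi₂ s hs s' hs') (hiF₂ s hs s' hs')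
      (by filter_upwards [hb₁] with z hz s hs; exact hz s hs s' hs'U) hb₁i
      (by filter_upwards [hb₁F] with z hz s hs; exact hz s hs s' hs'U) hb₁Fi
      (by filter_upwards [hb₁₂] with z hz s hs; exact hz s hs s' hs'U) hb₁₂i
      (by filter_upwards [hb₁₂F] with z hz s hs; exact hz s hs s' hs'U) hb₁₂Fi
      (by filter_upwards [hd₁] with z hz s hs; exact hz s hs s' hs'U)
      (by filter_upwards [hd₁₂] with z hz s hs; exact hz s hs s' hs'U) (hZ s hs s' hs')


/-! ## §4 The score ∕ cumulant reading of the N-form mixed kernel -/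

/-- ★ **N-FORM = `κ₃(G, r₁, r₂) + Cov(G, ∂₁r₂)`** (kernel-checked reading of ✓(L24) `hasDerivAt_response_family`'s value).  At one parameter point: weights `w` with partials
`w₁ w₂ w₁₂` (all `Z → ℝ`), the CUT clause «`w = 0 ⇒ w₁ = w₂ = w₁₂ = 0`» a.e., mass `Z := ∫ w ≠ 0`, normalised law `ŵ := w ∕ Z`, scores `r₁ := w₁∕w`, `r₂ := w₂∕w`, `r₁₂ := w₁₂∕w`
(so `r₁₂ − r₁·r₂ = ∂₁(w₂∕w)` where `w ≠ 0`), expectations `E[X] := ∫ X·ŵ`; if the ten products `G, r₁, r₂, r₁₂, G·r₁, G·r₂, G·r₁₂, r₁·r₂, G·r₁·r₂` (× `ŵ`) and `ŵ` are integrable, then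
the raw N-form `(N₁₂(G) − N₂(G)N₁(1)) − ((N₁(G) − E(G)N₁(1))·N₂(1) + E(G)·(N₁₂(1) − N₂(1)N₁(1)))` (`Nᵢ(G) = ∫ G·wᵢ ∕ Z`) EQUALS the centred third cumulant
`∫ (G − E G)(r₁ − E r₁)(r₂ − E r₂)·ŵ` PLUS the centred covariance `∫ (G − E G)((r₁₂ − r₁ r₂) − E[r₁₂ − r₁ r₂])·ŵ`. [folklore] -/
theorem nForm_eq_cum3_add_cov {w w₁ w₂ w₁₂ G : Z → ℝ} (h0 : ∀ᵐ z ∂τ, w z = 0 → w₁ z = 0 ∧ w₂ z = 0 ∧ w₁₂ z = 0) (hZ : ∫ z, w z ∂τ ≠ 0)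
    (hw : Integrable (fun z => w z / ∫ z', w z' ∂τ) τ)
    (hG : Integrable (fun z => G z * (w z / ∫ z', w z' ∂τ)) τ)
    (hr₁ : Integrable (fun z => (w₁ z / w z) * (w z / ∫ z', w z' ∂τ)) τ) (hr₂ : Integrable (fun z => (w₂ z / w z) * (w z / ∫ z', w z' ∂τ)) τ)
    (hr₁₂ : Integrable (fun z => (w₁₂ z / w z) * (w z / ∫ z', w z' ∂τ)) τ)
    (hGr₁ : Integrable (fun z => G z * (w₁ z / w z) * (w z / ∫ z', w z' ∂τ)) τ) (hGr₂ : Integrable (fun z => G z * (w₂ z / w z) * (w z / ∫ z', w z' ∂τ)) τ)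
    (hGr₁₂ : Integrable (fun z => G z * (w₁₂ z / w z) * (w z / ∫ z', w z' ∂τ)) τ)
    (hr₁r₂ : Integrable (fun z => (w₁ z / w z) * (w₂ z / w z) * (w z / ∫ z', w z' ∂τ)) τ)
    (hGr₁r₂ : Integrable (fun z => G z * (w₁ z / w z) * (w₂ z / w z) * (w z / ∫ z', w z' ∂τ)) τ) :
    (((∫ z, G z * w₁₂ z ∂τ) / (∫ z, w z ∂τ) - ((∫ z, G z * w₂ z ∂τ) / (∫ z, w z ∂τ)) * ((∫ z, w₁ z ∂τ) / (∫ z, w z ∂τ)))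
      - ((((∫ z, G z * w₁ z ∂τ) / (∫ z, w z ∂τ) - ((∫ z, G z * w z ∂τ) / (∫ z, w z ∂τ)) * ((∫ z, w₁ z ∂τ) / (∫ z, w z ∂τ)))
          * ((∫ z, w₂ z ∂τ) / (∫ z, w z ∂τ)))
        + ((∫ z, G z * w z ∂τ) / (∫ z, w z ∂τ))
          * ((∫ z, w₁₂ z ∂τ) / (∫ z, w z ∂τ) - ((∫ z, w₂ z ∂τ) / (∫ z, w z ∂τ)) * ((∫ z, w₁ z ∂τ) / (∫ z, w z ∂τ)))))
      = (∫ z, (G z - ∫ z', G z' * (w z' / ∫ z'', w z'' ∂τ) ∂τ) * ((w₁ z / w z) - ∫ z', (w₁ z' / w z') * (w z' / ∫ z'', w z'' ∂τ) ∂τ)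
            * ((w₂ z / w z) - ∫ z', (w₂ z' / w z') * (w z' / ∫ z'', w z'' ∂τ) ∂τ) * (w z / ∫ z', w z' ∂τ) ∂τ)
        + (∫ z, (G z - ∫ z', G z' * (w z' / ∫ z'', w z'' ∂τ) ∂τ)
            * (((w₁₂ z / w z) - (w₁ z / w z) * (w₂ z / w z)) - ∫ z', ((w₁₂ z' / w z') - (w₁ z' / w z') * (w₂ z' / w z')) * (w z' / ∫ z'', w z'' ∂τ) ∂τ)
            * (w z / ∫ z', w z' ∂τ) ∂τ) := by
  -- normalisation of `ŵ`
  have h1 : ∫ z, w z / ∫ z', w z' ∂τ ∂τ = 1 := by rw [integral_div, div_self hZ]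
  -- raw blocks as `ŵ`-expectations of the scores (cut clause where `w = 0`)
  have eN : ∀ v : Z → ℝ, (∀ᵐ z ∂τ, w z = 0 → v z = 0) → ∀ H : Z → ℝ,
      (∫ z, H z * v z ∂τ) / (∫ z, w z ∂τ) = ∫ z, H z * (v z / w z) * (w z / ∫ z', w z' ∂τ) ∂τ := by
    intro v hv H
    rw [← integral_div]
    refine integral_congr_ae ?_
    filter_upwards [hv] with z hz
    by_cases hw0 : w z = 0
    · rw [hw0, hz hw0]; simp
    · field_simp
  have h₁ : ∀ᵐ z ∂τ, w z = 0 → w₁ z = 0 := by filter_upwards [h0] with z hz h using (hz h).1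
  have h₂ : ∀ᵐ z ∂τ, w z = 0 → w₂ z = 0 := by filter_upwards [h0] with z hz h using (hz h).2.1
  have h₁₂ : ∀ᵐ z ∂τ, w z = 0 → w₁₂ z = 0 := by filter_upwards [h0] with z hz h using (hz h).2.2
  have eG : (∫ z, G z * w z ∂τ) / (∫ z, w z ∂τ) = ∫ z, G z * (w z / ∫ z', w z' ∂τ) ∂τ := (integral_mul_div_const G w _).symm
  have e1 : ∀ v : Z → ℝ, (∀ᵐ z ∂τ, w z = 0 → v z = 0) → (∫ z, v z ∂τ) / (∫ z, w z ∂τ) = ∫ z, (v z / w z) * (w z / ∫ z', w z' ∂τ) ∂τ := by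
    intro v hv
    have h := eN v hv (fun _ => 1)
    simp only [one_mul] at h
    exact h
  rw [eN w₁₂ h₁₂ G, eN w₂ h₂ G, eN w₁ h₁ G, e1 w₁ h₁, e1 w₂ h₂, e1 w₁₂ h₁₂, eG]
  -- the two centred brackets in block form
  have hD : Integrable (fun z => ((w₁₂ z / w z) - (w₁ z / w z) * (w₂ z / w z)) * (w z / ∫ z', w z' ∂τ)) τ := by
    have e : (fun z => ((w₁₂ z / w z) - (w₁ z / w z) * (w₂ z / w z)) * (w z / ∫ z', w z' ∂τ))
        = fun z => (w₁₂ z / w z) * (w z / ∫ z', w z' ∂τ) - (w₁ z / w z) * (w₂ z / w z) * (w z / ∫ z', w z' ∂τ) := by funext z; ring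
    rw [e]; exact hr₁₂.sub hr₁r₂
  have hGD : Integrable (fun z => G z * ((w₁₂ z / w z) - (w₁ z / w z) * (w₂ z / w z)) * (w z / ∫ z', w z' ∂τ)) τ := by
    have e : (fun z => G z * ((w₁₂ z / w z) - (w₁ z / w z) * (w₂ z / w z)) * (w z / ∫ z', w z' ∂τ))
        = fun z => G z * (w₁₂ z / w z) * (w z / ∫ z', w z' ∂τ) - G z * (w₁ z / w z) * (w₂ z / w z) * (w z / ∫ z', w z' ∂τ) := by funext z; ring
    rw [e]; exact hGr₁₂.sub hGr₁r₂
  rw [integral_centred_mul3_eq h1 hG hr₁ hr₂ hGr₁ hGr₂ hr₁r₂ hGr₁r₂ hw,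
    integral_centred_mul_eq (B := fun z => (w₁₂ z / w z) - (w₁ z / w z) * (w₂ z / w z)) h1 hG hD hGD hw]
  have eD : (∫ z, ((w₁₂ z / w z) - (w₁ z / w z) * (w₂ z / w z)) * (w z / ∫ z', w z' ∂τ) ∂τ)
      = (∫ z, (w₁₂ z / w z) * (w z / ∫ z', w z' ∂τ) ∂τ) - (∫ z, (w₁ z / w z) * (w₂ z / w z) * (w z / ∫ z', w z' ∂τ) ∂τ) := by
    rw [← integral_sub hr₁₂ hr₁r₂]; exact integral_congr_ae (Eventually.of_forall fun z => by ring)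
  have eGD : (∫ z, G z * ((w₁₂ z / w z) - (w₁ z / w z) * (w₂ z / w z)) * (w z / ∫ z', w z' ∂τ) ∂τ)
      = (∫ z, G z * (w₁₂ z / w z) * (w z / ∫ z', w z' ∂τ) ∂τ) - (∫ z, G z * (w₁ z / w z) * (w₂ z / w z) * (w z / ∫ z', w z' ∂τ) ∂τ) := by
    rw [← integral_sub hGr₁₂ hGr₁r₂]; exact integral_congr_ae (Eventually.of_forall fun z => by ring)
  rw [eD, eGD]
  ring

end Summit.QuantumFields.YangMills.Theorems.OrganTangentLawCumulantResponse

end
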